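import Literature.NumberTheory.GelbartRogawski1991.LocalDoubledUnitarySiegel
import Literature.NumberTheory.GelbartRogawski1991.DoubledUnitaryAdaptedBlocks
import Literature.NumberTheory.Automorphic.UnitaryGroupSplitPlace
import HarnessLib

-- buildfix G11b-3 recipe (LEDGER B13-1/B13-3): elaborate sequentially so the trailing `attribute [implicit_reducible]`
-- block (reducibilityCoreExt is keyed to the async environment branch) is in force at `.olean` export.
set_option Elab.async false

/-!
# `χ_w(det p_w) = χ_v(det_Δ p)` on the Siegel parabolic `P_Δ` at a SPLIT place

[cite: HarrisKudlaSweet1996, §1 (1.15); Kudla1994, §3; GelbartRogawski1991, §3.1 (3.1.2) p. 456]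

At a place `v` of `F` that splits in `E` (`w ≠ c w` above `v`), the doubled unitary group `H(F_v) ⊂ GL_{2n}(E_w) ×
GL_{2n}(E_{cw})` projects isomorphically onto `GL_{2n}(E_w)`, and the prescribed parabolic values
`χ_v(det_Δ p) = χ_w(det_Δ p_w) · χ_{c⁻¹w}(det_Δ p_{c⁻¹w})` of the local splitting on `P_Δ` (`chiDet`) are the
restriction of the CHARACTER `χ_w ∘ det ∘ pr_w` of `H(F_v)` — provided the two local characters are tied by
`χ_{c⁻¹ w} = χ_w⁻¹ ∘ c_*` (the local shadow at a split place of `χ|_{𝔸_F^×} = ε_{E/F}`): `chi_det_eq_chiDet`.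

Proof: for `p ∈ P_Δ` the adapted blocks of `p_w` are `[[A, B], [0, D]]` with `det_Δ p_w = det A`
(`LocalDoubledUnitarySiegel.isSiegelDelta_iff_blocks`), so `det p_w = det A · det D`; the unitarity relation
`(c_* p_{c⁻¹w})ᵀ J p_w = J` (`UnitaryGroup.mem_localPi_iff`) reads `[[A′,B′],[0,D′]]ᵀ · antidiag(2T, 2T) · [[A,B],[0,D]]
= antidiag(2T, 2T)` in adapted blocks, whence `det A′ · det D = 1` for `A′ =` the `Δ`-block of `c_* p_{c⁻¹w}` (§1);
and `χ_{c⁻¹w}(det_Δ p_{c⁻¹w}) = χ_w(det A′)⁻¹ = χ_w(det D)`.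
-/

set_option autoImplicit false

noncomputable section

open NumberField IsDedekindDomain Matrix
open Literature.NumberTheory.Automorphic Literature.NumberTheory.Automorphic.UnitaryGroup
open Literature.NumberTheory.GelbartRogawski1991.AdaptedBlocks

/-! ## §1 Adapted blocks of a pair `Mᵀ (T ⊕ −T) N = T ⊕ −T` of block-upper-triangular matrices -/

namespace Literature.NumberTheory.GelbartRogawski1991.AdaptedBlocks

variable {L : Type*} [CommRing L] {ι : Type*} [DecidableEq ι]

/-- `Rᵀ = R`. [cite: HarrisKudlaSweet1996, §1 (1.11)] -/
theorem cayR_transpose : (cayR L ι)ᵀ = cayR L ι := by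
  rw [cayR, Matrix.fromBlocks_transpose, Matrix.transpose_one, Matrix.transpose_neg, Matrix.transpose_one]

/-- `(R⁻¹)ᵀ = R⁻¹`. [cite: HarrisKudlaSweet1996, §1 (1.11)] -/
theorem cayRinv_transpose [Invertible (2 : L)] : (cayRinv L ι)ᵀ = cayRinv L ι := by
  rw [cayRinv, Matrix.transpose_smul, cayR_transpose]

/-- `Rᵀ (T ⊕ −T) R = antidiag(T + T, T + T)`. [cite: HarrisKudlaSweet1996, §1 (1.11)] -/
theorem cayR_mul_diagForm_mul_cayR [Fintype ι] (T : Matrix ι ι L) :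
    cayR L ι * Matrix.fromBlocks T 0 0 (-T) * cayR L ι = Matrix.fromBlocks 0 (T + T) (T + T) 0 := by
  rw [cayR, Matrix.fromBlocks_multiply, Matrix.fromBlocks_multiply]
  simp only [Matrix.one_mul, Matrix.mul_one, Matrix.mul_zero, zero_add, add_zero, Matrix.mul_neg,
    Matrix.neg_mul, neg_neg]
  congr 1 <;> abel

/-- the relation `Mᵀ (T ⊕ −T) N = T ⊕ −T` in the adapted frame: `(adapt M)ᵀ · antidiag(T+T, T+T) · adapt N =
antidiag(T+T, T+T)`. [cite: HarrisKudlaSweet1996, §1 (1.11)] -/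
theorem adapt_transpose_mul_antidiag_mul_adapt [Fintype ι] [Invertible (2 : L)] (T : Matrix ι ι L) {M N : Matrix (ι ⊕ ι) (ι ⊕ ι) L}
    (hMN : Mᵀ * Matrix.fromBlocks T 0 0 (-T) * N = Matrix.fromBlocks T 0 0 (-T)) :
    (adapt M)ᵀ * Matrix.fromBlocks 0 (T + T) (T + T) 0 * adapt N = Matrix.fromBlocks 0 (T + T) (T + T) 0 := by
  rw [← cayR_mul_diagForm_mul_cayR, adapt, adapt, Matrix.transpose_mul, Matrix.transpose_mul, cayR_transpose,
    cayRinv_transpose]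
  have e : cayR L ι * (Mᵀ * cayRinv L ι) * (cayR L ι * Matrix.fromBlocks T 0 0 (-T) * cayR L ι) *
      (cayRinv L ι * N * cayR L ι) =
      cayR L ι * Mᵀ * (cayRinv L ι * cayR L ι) * Matrix.fromBlocks T 0 0 (-T) * (cayR L ι * cayRinv L ι) * N * cayR L ι := by
    simp only [Matrix.mul_assoc]
  rw [e, cayRinv_mul_cayR, cayR_mul_cayRinv, Matrix.mul_one, Matrix.mul_one, Matrix.mul_assoc (cayR L ι) Mᵀ,
    Matrix.mul_assoc (cayR L ι) (Mᵀ * _), hMN]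

/-- **`det A′ · det D = 1`** for block-upper-triangular (in the adapted frame) `M`, `N` with `Mᵀ (T ⊕ −T) N = T ⊕ −T`,
`A′ = A(M)`, `D = D(N)`, `T` invertible. [cite: HarrisKudlaSweet1996, §1 (1.15); Kudla1994, §3] -/
theorem det_blkA_mul_det_blkD_eq_one [Fintype ι] [Invertible (2 : L)] {T : Matrix ι ι L} (hT : IsUnit T.det) {M N : Matrix (ι ⊕ ι) (ι ⊕ ι) L}
    (hMN : Mᵀ * Matrix.fromBlocks T 0 0 (-T) * N = Matrix.fromBlocks T 0 0 (-T)) (hM : blkC M = 0) (hN : blkC N = 0) :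
    (blkA M).det * (blkD N).det = 1 := by
  have h := adapt_transpose_mul_antidiag_mul_adapt T hMN
  rw [adapt_eq M, adapt_eq N, hM, hN, Matrix.fromBlocks_transpose, Matrix.fromBlocks_multiply,
    Matrix.fromBlocks_multiply] at h
  have h12 := (Matrix.fromBlocks_inj.1 h).2.1
  simp only [Matrix.transpose_zero, Matrix.zero_mul, Matrix.mul_zero, add_zero, zero_add] at h12
  -- `h12 : (blkA M)ᵀ * (T + T) * blkD N = T + T`
  have hτ : IsUnit (T + T).det := by
    rw [← two_smul L T, Matrix.det_smul]
    exact ((isUnit_of_invertible (2 : L)).pow _).mul hT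
  have hd := congrArg Matrix.det h12
  rw [Matrix.det_mul, Matrix.det_mul, Matrix.det_transpose, mul_right_comm] at hd
  exact hτ.mul_left_inj.1 (hd.trans (one_mul _).symm)

end Literature.NumberTheory.GelbartRogawski1991.AdaptedBlocks

namespace Literature.NumberTheory.GelbartRogawski1991.UnitaryDualPair.LocalSplitting

variable (F : Type) [Field F] [NumberField F] (E : Type) [Field E] [NumberField E] [Algebra F E]
  [Algebra.IsQuadraticExtension F E] (c : E ≃ₐ[F] E)
  {δ : E} (hcδ : c δ = -δ) (hδ : δ ≠ 0) {d : F} (hd : δ * δ = algebraMap F E d)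
  (v : HeightOneSpectrum (𝓞 F)) (n : ℕ) {T₀ : Matrix (Fin n) (Fin n) F} (hT₀ : T₀.IsSymm) (hT₀d : IsUnit T₀.det)
  {JD : Matrix (Fin (n + n)) (Fin (n + n)) E} (hJD : JD = (gramD F n T₀).map (algebraMap F E))

/-! ## §2 The components of `p ∈ P_Δ` at the two places above a split `v` -/

/-- `T₀` over `E_w`. [cite: HarrisKudlaSweet1996, §1 (1.9)] -/
abbrev gramW (w : PlacesOver E v) : Matrix (Fin n) (Fin n) (w.1.adicCompletion E) :=
  (T₀.map (algebraMap F E)).map (algebraMap E (w.1.adicCompletion E))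

/-- the adapted matrix of the `w`-component of `h ∈ H(F_v)`. [cite: Kudla1994, §3] -/
abbrev matW (w : PlacesOver E v) (h : UnitaryGroup.localPi E c (n + n) JD v) :
    Matrix (Fin n ⊕ Fin n) (Fin n ⊕ Fin n) (w.1.adicCompletion E) :=
  Matrix.reindex (e₂ n).symm (e₂ n).symm
    (((h : UnitaryGroup.LocalGLPi E (n + n) v) w : GL (Fin (n + n)) (w.1.adicCompletion E)) :
      Matrix (Fin (n + n)) (Fin (n + n)) (w.1.adicCompletion E))

omit [Algebra.IsQuadraticExtension F E] in
include hJD in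
/-- the form matrix at `w` is `e₂`-reindexed `T₀ ⊕ (−T₀)`. [cite: HarrisKudlaSweet1996, §1 (1.9)] -/
theorem placeForm_eq (w : PlacesOver E v) :
    placeForm JD w.1 = Matrix.reindex (e₂ n) (e₂ n) (Matrix.fromBlocks (gramW F E v n (T₀ := T₀) w) 0 0 (-gramW F E v n (T₀ := T₀) w)) := by
  rw [placeForm, hJD]
  ext i j
  simp only [gramD, Matrix.map_apply, Matrix.reindex_apply, Matrix.submatrix_apply]
  rcases (e₂ n).symm i with a | a <;> rcases (e₂ n).symm j with b | b <;>
    simp [Matrix.fromBlocks, map_neg, map_zero]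

omit [NumberField F] [Algebra.IsQuadraticExtension F E] in
include hT₀d in
/-- `det (T₀ ⊗ 1)` is a unit in `E_w`. [cite: HarrisKudlaSweet1996, §1 (1.9)] -/
theorem isUnit_det_gramW (w : PlacesOver E v) : IsUnit (gramW F E v n (T₀ := T₀) w).det := by
  rw [gramW, ← RingHom.mapMatrix_apply, ← RingHom.mapMatrix_apply, ← RingHom.map_det, ← RingHom.map_det]
  exact (hT₀d.map _).map _

/-- `C = 0` for the components of `p ∈ P_Δ`. [cite: Kudla1994, §3] -/
theorem blkC_matW_eq_zero {p : UnitaryGroup.localPi E c (n + n) JD v} (hp : IsSiegelDelta F E c hcδ hδ hd v n hT₀ hJD p)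
    (w : PlacesOver E v) : blkC (matW F E c v n w p) = 0 :=
  (blkC_eq_zero_iff _).2 ((isSiegelDelta_iff_blocks F E c hcδ hδ hd v n hT₀ hJD p).1 hp w)

/-- `det_Δ p_w = det A(p_w)` on `P_Δ`. [cite: Kudla1994, §3; HarrisKudlaSweet1996, §1 (1.15)] -/
theorem detDelta_eq_det_blkA {p : UnitaryGroup.localPi E c (n + n) JD v}
    (hp : IsSiegelDelta F E c hcδ hδ hd v n hT₀ hJD p) (w : PlacesOver E v) :
    detDelta F E c v n w p = (blkA (matW F E c v n w p)).det := by
  rw [blkA_eq_of_blkC_eq_zero (blkC_matW_eq_zero F E c hcδ hδ hd v n hT₀ hJD hp w)]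
  rfl

/-- `det p_w = det A · det D` on `P_Δ`. [cite: Kudla1994, §3] -/
theorem det_eq_det_blkA_mul_det_blkD {p : UnitaryGroup.localPi E c (n + n) JD v}
    (hp : IsSiegelDelta F E c hcδ hδ hd v n hT₀ hJD p) (w : PlacesOver E v) :
    (((p : UnitaryGroup.LocalGLPi E (n + n) v) w : GL (Fin (n + n)) (w.1.adicCompletion E)) :
        Matrix (Fin (n + n)) (Fin (n + n)) (w.1.adicCompletion E)).det =
      (blkA (matW F E c v n w p)).det * (blkD (matW F E c v n w p)).det := by
  have hC := blkC_matW_eq_zero F E c hcδ hδ hd v n hT₀ hJD hp w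
  have e1 : (matW F E c v n w p).det =
      (((p : UnitaryGroup.LocalGLPi E (n + n) v) w : GL (Fin (n + n)) (w.1.adicCompletion E)) :
        Matrix (Fin (n + n)) (Fin (n + n)) (w.1.adicCompletion E)).det := by
    rw [matW, Matrix.reindex_apply, Equiv.symm_symm, Matrix.det_submatrix_equiv_self]
  have e2 : (adapt (matW F E c v n w p)).det = (matW F E c v n w p).det := by
    rw [adapt, Matrix.det_mul, Matrix.det_mul, mul_comm (cayRinv _ _).det, mul_assoc, ← Matrix.det_mul,
      cayRinv_mul_cayR, Matrix.det_one, mul_one]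
  rw [← e1, ← e2, adapt_eq, hC, Matrix.det_fromBlocks_zero₂₁]

omit [Algebra.IsQuadraticExtension F E] in
include hJD in
/-- the unitarity relation between the two components of `p ∈ H(F_v)` above a split place, in adapted coordinates:
`(c_* p_{c⁻¹w})ᵀ (T₀ ⊕ −T₀) p_w = T₀ ⊕ −T₀`. [cite: GelbartRogawski1991, §3.1 p. 456; Kudla1994, §3] -/
theorem transpose_conj_mul_form_mul (p : UnitaryGroup.localPi E c (n + n) JD v) (w : PlacesOver E v) :
    ((matW F E c v n (PlacesOver.galInv c w) p).map (galAdicCompletionMap c (smul_inv_smul c w.1)))ᵀ *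
        Matrix.fromBlocks (gramW F E v n (T₀ := T₀) w) 0 0 (-gramW F E v n (T₀ := T₀) w) * matW F E c v n w p =
      Matrix.fromBlocks (gramW F E v n (T₀ := T₀) w) 0 0 (-gramW F E v n (T₀ := T₀) w) := by
  have h := (mem_localPi_iff E c (n + n) JD v (p : UnitaryGroup.LocalGLPi E (n + n) v)).1 p.2 w
  rw [placeForm_eq F E v n hJD] at h
  -- re-enumerate by `e₂`
  have key := congrArg (fun X => Matrix.reindex (e₂ n).symm (e₂ n).symm X) h
  simp only [Matrix.reindex_apply, Equiv.symm_symm, ← Matrix.submatrix_mul_equiv _ _ (e₂ n) (e₂ n) (e₂ n),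
    Matrix.submatrix_submatrix, Equiv.symm_comp_self, Matrix.submatrix_id_id] at key
  rw [matW, matW, Matrix.reindex_apply, Matrix.reindex_apply, Equiv.symm_symm, ← Matrix.submatrix_map,
    Matrix.transpose_submatrix]
  exact key

/-- `C(c_* p_{c⁻¹w}) = 0` for `p ∈ P_Δ`. [cite: Kudla1994, §3] -/
theorem blkC_map_matW_eq_zero {p : UnitaryGroup.localPi E c (n + n) JD v}
    (hp : IsSiegelDelta F E c hcδ hδ hd v n hT₀ hJD p) (w : PlacesOver E v) :
    blkC ((matW F E c v n (PlacesOver.galInv c w) p).map (galAdicCompletionMap c (smul_inv_smul c w.1))) = 0 := by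
  have h := (isSiegelDelta_iff_blocks F E c hcδ hδ hd v n hT₀ hJD p).1 hp (PlacesOver.galInv c w)
  refine (blkC_eq_zero_iff _).2 ?_
  have := congrArg (fun X : Matrix (Fin n) (Fin n) _ => X.map (galAdicCompletionMap c (smul_inv_smul c w.1))) h
  simp only [Matrix.map_add _ (map_add _)] at this
  exact this

/-- `c_* (det_Δ p_{c⁻¹w}) = det A(c_* p_{c⁻¹w})`. [cite: Kudla1994, §3; HarrisKudlaSweet1996, §1 (1.15)] -/
theorem map_detDelta_galInv {p : UnitaryGroup.localPi E c (n + n) JD v}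
    (hp : IsSiegelDelta F E c hcδ hδ hd v n hT₀ hJD p) (w : PlacesOver E v) :
    galAdicCompletionMap c (smul_inv_smul c w.1) (detDelta F E c v n (PlacesOver.galInv c w) p) =
      (blkA ((matW F E c v n (PlacesOver.galInv c w) p).map (galAdicCompletionMap c (smul_inv_smul c w.1)))).det := by
  rw [blkA_eq_of_blkC_eq_zero (blkC_map_matW_eq_zero F E c hcδ hδ hd v n hT₀ hJD hp w), detDelta_eq_det_blkA F E c hcδ hδ hd v n hT₀ hJD hp,
    blkA_eq_of_blkC_eq_zero (blkC_matW_eq_zero F E c hcδ hδ hd v n hT₀ hJD hp _), RingHom.map_det, RingHom.mapMatrix_apply,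
    Matrix.map_add _ (map_add _)]
  rfl

include hT₀d in
/-- **`c_*(det_Δ p_{c⁻¹w}) · det D(p_w) = 1`** for `p ∈ P_Δ`. [cite: Kudla1994, §3; HarrisKudlaSweet1996, §1 (1.15)] -/
theorem map_detDelta_galInv_mul_det_blkD {p : UnitaryGroup.localPi E c (n + n) JD v}
    (hp : IsSiegelDelta F E c hcδ hδ hd v n hT₀ hJD p) (w : PlacesOver E v) :
    galAdicCompletionMap c (smul_inv_smul c w.1) (detDelta F E c v n (PlacesOver.galInv c w) p) *
        (blkD (matW F E c v n w p)).det = 1 := by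
  rw [map_detDelta_galInv F E c hcδ hδ hd v n hT₀ hJD hp w]
  exact det_blkA_mul_det_blkD_eq_one (isUnit_det_gramW F E v n hT₀d w) (transpose_conj_mul_form_mul F E c v n hJD p w)
    (blkC_map_matW_eq_zero F E c hcδ hδ hd v n hT₀ hJD hp w) (blkC_matW_eq_zero F E c hcδ hδ hd v n hT₀ hJD hp w)

/-! ## §3 `χ_w(det p_w) = χ_v(det_Δ p)` -/

include hcδ hδ in
/-- at a split place the places above `v` are `w` and `c⁻¹ w`. [cite: CasselsFrohlichANT1967, Ch. VII Prop. 1.2 (ii)] -/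
theorem univ_eq_pair [DecidableEq (PlacesOver E v)] (w : PlacesOver E v) :
    (Finset.univ : Finset (PlacesOver E v)) = {w, PlacesOver.galInv c w} := by
  ext w'
  simp only [Finset.mem_univ, Finset.mem_insert, Finset.mem_singleton, true_iff]
  have hc : c ≠ 1 := by
    intro h1; apply hδ
    have h2 : (2 : E) * δ = 0 := by
      have : δ = -δ := by simpa [h1] using hcδ
      linear_combination this
    exact (mul_eq_zero.1 h2).resolve_left two_ne_zero
  exact PlacesOver.eq_or_eq_galInv c hc w w'

include hcδ hδ hd hT₀ hT₀d hJD in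
/-- **`χ_w(det p_w) = χ_v(det_Δ p)` on `P_Δ(F_v)` at a split place**, for local characters tied by
`χ_{c⁻¹w} = χ_w⁻¹ ∘ c_*`. [cite: HarrisKudlaSweet1996, §1 (1.15); GelbartRogawski1991, §3.1 (3.1.2) p. 456] -/
theorem chi_det_eq_chiDet (w : PlacesOver E v) (hw : c • w.1 ≠ w.1)
    (χv : ∀ w' : PlacesOver E v, (w'.1.adicCompletion E)ˣ →* ℂˣ)
    (hχ : ∀ x : ((PlacesOver.galInv c w).1.adicCompletion E)ˣ,
      χv (PlacesOver.galInv c w) x = (χv w (Units.map (galAdicCompletionMap c (smul_inv_smul c w.1)).toMonoidHom x))⁻¹)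
    (p : UnitaryGroup.localPi E c (n + n) JD v) (hp : IsSiegelDelta F E c hcδ hδ hd v n hT₀ hJD p) :
    χv w (Matrix.GeneralLinearGroup.det ((p : UnitaryGroup.LocalGLPi E (n + n) v) w)) = chiDet F E c v n χv p := by
  classical
  set w' := PlacesOver.galInv c w with hw'
  have hne : w' ≠ w := PlacesOver.galInv_ne c w hw
  -- the units
  have hdet := det_eq_det_blkA_mul_det_blkD F E c hcδ hδ hd v n hT₀ hJD hp w
  have hGL : IsUnit (((p : UnitaryGroup.LocalGLPi E (n + n) v) w : GL (Fin (n + n)) (w.1.adicCompletion E)) :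
      Matrix (Fin (n + n)) (Fin (n + n)) (w.1.adicCompletion E)).det :=
    (Matrix.isUnit_iff_isUnit_det _).1 (Units.isUnit _)
  rw [hdet] at hGL
  have hA : IsUnit (blkA (matW F E c v n w p)).det := (IsUnit.mul_iff.1 hGL).1
  have hD : IsUnit (blkD (matW F E c v n w p)).det := (IsUnit.mul_iff.1 hGL).2
  have hrel := map_detDelta_galInv_mul_det_blkD F E c hcδ hδ hd v n hT₀ hT₀d hJD hp w
  have hA'u : IsUnit (galAdicCompletionMap c (smul_inv_smul c w.1) (detDelta F E c v n w' p)) :=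
    IsUnit.of_mul_eq_one _ hrel
  have hΔw : IsUnit (detDelta F E c v n w p) := by rwa [detDelta_eq_det_blkA F E c hcδ hδ hd v n hT₀ hJD hp w]
  have hΔw' : IsUnit (detDelta F E c v n w' p) := by
    rw [isUnit_iff_ne_zero]
    intro h0
    rw [h0, map_zero] at hA'u
    exact not_isUnit_zero hA'u
  -- unfold `chiDet` over the two places
  rw [chiDet, univ_eq_pair F E c hcδ hδ v w, Finset.prod_pair hne.symm, dif_pos hΔw, dif_pos hΔw', hχ]
  -- `c_* (det_Δ p_{w'}) = (det D)⁻¹` as units, `det_Δ p_w = det A`, `det p_w = det A det D`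
  have hu1 : Units.map (galAdicCompletionMap c (smul_inv_smul c w.1)).toMonoidHom hΔw'.unit = hD.unit⁻¹ := by
    rw [eq_inv_iff_mul_eq_one]
    apply Units.ext
    simp only [Units.val_mul, Units.coe_map, RingHom.toMonoidHom_eq_coe, MonoidHom.coe_coe, IsUnit.unit_spec,
      Units.val_one]
    exact hrel
  have hu2 : Matrix.GeneralLinearGroup.det ((p : UnitaryGroup.LocalGLPi E (n + n) v) w) = hΔw.unit * hD.unit := by
    apply Units.ext
    rw [Matrix.GeneralLinearGroup.val_det_apply, Units.val_mul, IsUnit.unit_spec, IsUnit.unit_spec,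
      detDelta_eq_det_blkA F E c hcδ hδ hd v n hT₀ hJD hp w]
    exact hdet
  rw [hu1, _root_.map_inv, inv_inv, hu2, _root_.map_mul]

/-! ### Build-lane note (ops-buildfix G11b-3 recipe, LEDGER B13-1, 2026-08-21)
`lean -o` (the hub build lane, never `lean`/the gate check) runs Lean 4.32's library-suggestion indexers
(`Lean.LibrarySuggestions.SymbolFrequency` / `SineQuaNon`, from their `exportEntriesFn`) over the statement of
every local theorem that is not a denied premise; on this family's statements (very large dependent binder
telescopes through the theta-kernel / dual-pair data) that fold runs for tens of minutes to hours and the build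
lane kills the job (incident G11b-3, run/shared/lean/ops/buildfix/G11b-3-DOSSIER.md). `isDeniedPremise` skips
`[implicit_reducible]` constants before any fold, and a reducibility status on a *theorem* is inert (Meta never
unfolds `thmInfo`; the kernel ignores the attribute), so the public theorems of this file are tagged
`[implicit_reducible]` purely to keep them out of that index. Only other effect: they are not offered by
`+suggestions` premise selectors. No statement or proof is changed; superseded if the operator lands a
deny-list form (`HarnessLib.PremiseIndex`). -/
set_option allowUnsafeReducibility true in
attribute [implicit_reducible]
  _root_.Literature.NumberTheory.GelbartRogawski1991.AdaptedBlocks.cayR_transpose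
  _root_.Literature.NumberTheory.GelbartRogawski1991.AdaptedBlocks.cayRinv_transpose
  _root_.Literature.NumberTheory.GelbartRogawski1991.AdaptedBlocks.cayR_mul_diagForm_mul_cayR
  _root_.Literature.NumberTheory.GelbartRogawski1991.AdaptedBlocks.adapt_transpose_mul_antidiag_mul_adapt
  _root_.Literature.NumberTheory.GelbartRogawski1991.AdaptedBlocks.det_blkA_mul_det_blkD_eq_one
  placeForm_eq isUnit_det_gramW blkC_matW_eq_zero detDelta_eq_det_blkA det_eq_det_blkA_mul_det_blkD
  transpose_conj_mul_form_mul blkC_map_matW_eq_zero map_detDelta_galInv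
  map_detDelta_galInv_mul_det_blkD univ_eq_pair chi_det_eq_chiDet

end Literature.NumberTheory.GelbartRogawski1991.UnitaryDualPair.LocalSplitting

end
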